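import Summits.HubbardSuperconductivity.HubbardSuperconductivity.Theorems.AnisotropyChordTowerIdentities
import Mathlib.Analysis.MeanInequalities

/-!
# Route `AnisotropyChord` / H0 rotor rung: toward RUNG XY-LM_FM as a LANDED theorem — the lowering-norm law on
# extremal-weight amplitudes and the square-completion perturbation identity (port of theory seat
# `hubbard-h0-rotor-theory-1`, cycle 11, `Sketch11.lean` Parts F–G, memo ROTOR-THEORY-11 §156 (L2), (L5); work-order v12a)

* Part F: `zerosCard`, `raiseIter` (iterated raising), `ladderCoeff`, `lowerSum_raiseIter_succ`, `inner_raiseIter(_succ)`,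
  `normSq_raiseIter` and **`cg_ratio_identity`** — the Clebsch–Gordan shape `(S−M)(S−M−1)(S+M)(S+M−1)` from a factorial
  ratio, no Clebsch–Gordan;
* Part G (any finite index type, linear maps on `ι → ℝ`): **`square_completion`** (exact identity
  `⟨ψ,(A+ηW)ψ⟩ = ηα²⟨φ₀,Wφ₀⟩ − η²α²⟨φ₁,Aφ₁⟩ + ⟨ρ,Aρ⟩ + η⟨χ,Wχ⟩`, cross terms cancel) and `remainder_three_halves`
  (Rayleigh–Ritz + gap ⇒ `O(η^{3/2})` remainder).  Typing/proof authority: theory seat.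
-/

set_option linter.dupNamespace false
set_option autoImplicit false

noncomputable section

open Finset Filter Topology
open Summit.HubbardSuperconductivity.HubbardSuperconductivity.Theorems.AnisotropyChord.InsertionEntropy
open Literature.MathematicalPhysics.QuantumLattice Literature.Probability.LatticeModels

namespace Summit.HubbardSuperconductivity.HubbardSuperconductivity.Theorems.AnisotropyChord.Tower

/-! ## Part F — LOWERING-NORM LAW on extremal-weight amplitudes (memo §156 (L2)): the Clebsch–Gordan shape without Clebsch–Gordan

`raiseSum` raises the number of zeros by one (it is `S⁺_tot` in the zeros-up reading).  For an amplitude `b`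
supported on configurations with `n` zeros and annihilated by `lowerSum` (an extremal-weight vector, `2j = |V| − 2n`),
the iterates satisfy the pointwise ladder identity `lowerSum (raiseSum^{k+1} b) = (k+1)(2j−k) · raiseSum^k b` and hence
`‖raiseSum^k b‖² = (∏_{i<k} (i+1)(2j−i)) ‖b‖²`, polarised: `⟨raiseSum^k a, raiseSum^k b⟩ = (∏ …) ⟨a, b⟩`.  With
`j = S − 2` against `j = S` this product ratio is `cgShape S M / (2S(2S−1)(2S−2)(2S−3))` (memo §156 (L4)). -/

section LoweringNorm

variable {V : Type} [Fintype V] [DecidableEq V]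

/-- number of zeros of a configuration, as a real. -/
def zerosCard (ν : V → Fin 2) : ℝ := ((univ.filter fun x => ν x = 0).card : ℝ)

/-- Removing a particle decreases the particle count by one. [folklore] -/
theorem zerosCard_update_one {σ : V → Fin 2} {x : V} (hx : σ x = 0) :
    zerosCard σ = zerosCard (Function.update σ x 1) + 1 := by
  unfold zerosCard
  have hset : (univ.filter fun z => Function.update σ x 1 z = 0) = (univ.filter fun z => σ z = 0).erase x := by
    ext z
    simp only [Finset.mem_filter, Finset.mem_univ, true_and, Finset.mem_erase]
    by_cases hz : z = x
    · subst hz; simp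
    · rw [Function.update_of_ne hz]; simp [hz]
  have hxmem : x ∈ (univ.filter fun z => σ z = 0) := by simp [hx]
  rw [hset, Finset.card_erase_of_mem hxmem]
  have hpos : 1 ≤ (univ.filter fun z => σ z = 0).card := Finset.card_pos.mpr ⟨x, hxmem⟩
  push_cast [Nat.cast_sub hpos]
  ring

/-- iterated raising. -/
def raiseIter : ℕ → ((V → Fin 2) → ℝ) → ((V → Fin 2) → ℝ)
  | 0, b => b
  | k + 1, b => raiseSum (raiseIter k b)

/-- `B†` is homogeneous. [folklore] -/
theorem raiseSum_smul (c : ℝ) (b : (V → Fin 2) → ℝ) :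
    raiseSum (fun σ => c * b σ) = fun σ => c * raiseSum b σ := by
  funext σ; unfold raiseSum; rw [Finset.mul_sum]
  refine Finset.sum_congr rfl fun x _ => ?_
  split_ifs <;> simp

/-- `B` is homogeneous. [folklore] -/
theorem lowerSum_smul (c : ℝ) (b : (V → Fin 2) → ℝ) :
    lowerSum (fun σ => c * b σ) = fun σ => c * lowerSum b σ := by
  funext σ; unfold lowerSum; rw [Finset.mul_sum]
  refine Finset.sum_congr rfl fun x _ => ?_
  split_ifs <;> simp

/-- `B† 0 = 0`. [folklore] -/
theorem raiseSum_zero : raiseSum (fun _ : V → Fin 2 => (0:ℝ)) = fun _ => 0 := by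
  funext σ; unfold raiseSum; simp

/-- support propagation: `raiseSum` raises the number of zeros by one. -/
theorem raiseSum_support (b : (V → Fin 2) → ℝ) (n : ℝ)
    (hsupp : ∀ ν, b ν ≠ 0 → zerosCard ν = n) :
    ∀ σ, raiseSum b σ ≠ 0 → zerosCard σ = n + 1 := by
  intro σ hσ
  unfold raiseSum at hσ
  obtain ⟨x, _, hx⟩ := Finset.exists_ne_zero_of_sum_ne_zero hσ
  have hx0 : σ x = 0 := by
    by_contra h
    exact hx (by simp [h])
  have hb : b (Function.update σ x 1) ≠ 0 := by
    intro h0; exact hx (by simp [hx0, h0])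
  have := hsupp _ hb
  rw [zerosCard_update_one hx0, this]

/-- Iterated raising preserves the particle-number support bookkeeping. [folklore] -/
theorem raiseIter_support (b : (V → Fin 2) → ℝ) (n : ℝ)
    (hsupp : ∀ ν, b ν ≠ 0 → zerosCard ν = n) (k : ℕ) :
    ∀ σ, raiseIter k b σ ≠ 0 → zerosCard σ = n + k := by
  induction k with
  | zero => intro σ h; simpa [raiseIter] using hsupp σ h
  | succ k ih =>
      intro σ h
      have := raiseSum_support (raiseIter k b) (n + k) ih σ (by simpa [raiseIter] using h)
      rw [this]; push_cast; ring

/-- the ladder coefficient `(k+1)(2j−k)` with `2j = |V| − 2n`. -/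
def ladderCoeff (n : ℝ) (k : ℕ) : ℝ := ((k:ℝ) + 1) * (((Fintype.card V : ℝ) - 2 * n) - k)

/-- **POINTWISE LADDER IDENTITY** `S⁻ (S⁺)^{k+1} b = (k+1)(2j−k) (S⁺)^k b` for a lowest-weight amplitude
(`lowerSum b = 0`, support on `n` zeros). [folklore] -/
theorem lowerSum_raiseIter_succ (b : (V → Fin 2) → ℝ) (n : ℝ)
    (hsupp : ∀ ν, b ν ≠ 0 → zerosCard ν = n) (hlow : lowerSum b = fun _ => 0) (k : ℕ) :
    lowerSum (raiseIter (k + 1) b) = fun σ => ladderCoeff (V := V) n k * raiseIter k b σ := by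
  induction k with
  | zero =>
      funext σ
      show lowerSum (raiseSum b) σ = _
      have hc := commutator_pointwise b σ
      rw [hlow, raiseSum_zero] at hc
      simp only [sub_zero] at hc
      by_cases hb : b σ = 0
      · -- both sides vanish
        rw [hc, hb]; simp [raiseIter, hb]
      · have hz : zerosCard σ = n := hsupp σ hb
        have hV := card_holes_add_card_particles σ
        unfold zerosCard at hz
        rw [hc]
        simp only [raiseIter, ladderCoeff, Nat.cast_zero]
        rw [hz] at hV ⊢
        have h1 : ((univ.filter fun y => σ y = 1).card : ℝ) = (Fintype.card V : ℝ) - n := by linarith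
        rw [h1]; ring
  | succ k ih =>
      funext σ
      show lowerSum (raiseSum (raiseIter (k + 1) b)) σ = _
      have hc := commutator_pointwise (raiseIter (k + 1) b) σ
      rw [ih, raiseSum_smul] at hc
      simp only at hc
      -- hc : lowerSum (raiseSum c) σ - ladderCoeff n k * raiseSum (raiseIter k b) σ = (#ones - #zeros) * c σ
      by_cases hcσ : raiseIter (k + 1) b σ = 0
      · have : raiseSum (raiseIter k b) σ = 0 := by simpa [raiseIter] using hcσ
        rw [this, hcσ] at hc
        simp only [mul_zero, sub_zero] at hc
        rw [hc, hcσ, mul_zero]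
      · have hz : zerosCard σ = n + (k + 1 : ℕ) := raiseIter_support b n hsupp (k + 1) σ hcσ
        have hV := card_holes_add_card_particles σ
        unfold zerosCard at hz
        rw [hz] at hV
        have h1 : ((univ.filter fun y => σ y = 1).card : ℝ) = (Fintype.card V : ℝ) - (n + (k + 1 : ℕ)) := by
          linarith
        have hrs : raiseSum (raiseIter k b) σ = raiseIter (k + 1) b σ := rfl
        rw [hrs, h1, hz] at hc
        have : lowerSum (raiseSum (raiseIter (k + 1) b)) σ
            = (ladderCoeff (V := V) n k + ((Fintype.card V : ℝ) - (n + (k + 1 : ℕ)) - (n + (k + 1 : ℕ))))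
              * raiseIter (k + 1) b σ := by linear_combination hc
        rw [this]
        simp only [ladderCoeff]; push_cast; ring

/-- **LOWERING-NORM LAW (polarised)** `⟨(S⁺)^{k+1} a, (S⁺)^{k+1} b⟩ = (k+1)(2j−k) ⟨(S⁺)^k a, (S⁺)^k b⟩`. [folklore] -/
theorem inner_raiseIter_succ (a b : (V → Fin 2) → ℝ) (n : ℝ)
    (hsb : ∀ ν, b ν ≠ 0 → zerosCard ν = n) (hlb : lowerSum b = fun _ => 0) (k : ℕ) :
    ∑ σ, raiseIter (k + 1) a σ * raiseIter (k + 1) b σ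
      = ladderCoeff (V := V) n k * ∑ σ, raiseIter k a σ * raiseIter k b σ := by
  show ∑ σ, raiseSum (raiseIter k a) σ * raiseSum (raiseIter k b) σ = _
  -- adjointness: Σ (S⁺ x)(σ) (S⁺ y)(σ) = Σ x(ν) (S⁻ S⁺ y)(ν)
  have hadj := sum_mul_lowerSum_eq_sum_raiseSum_mul (raiseSum (raiseIter k b)) (raiseIter k a)
  -- hadj : Σ_ν (raiseIter k a) ν * lowerSum (raiseSum (raiseIter k b)) ν = Σ_σ raiseSum (raiseIter k a) σ * raiseSum (raiseIter k b) σ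
  rw [← hadj]
  have hl := lowerSum_raiseIter_succ b n hsb hlb k
  simp only [raiseIter] at hl ⊢
  rw [hl, Finset.mul_sum]
  exact Finset.sum_congr rfl fun ν _ => by ring

/-- **LOWERING-NORM LAW (closed form)** `⟨(S⁺)^k a, (S⁺)^k b⟩ = (∏_{i<k} (i+1)(2j−i)) ⟨a, b⟩`. [folklore] -/
theorem inner_raiseIter (a b : (V → Fin 2) → ℝ) (n : ℝ)
    (hsb : ∀ ν, b ν ≠ 0 → zerosCard ν = n) (hlb : lowerSum b = fun _ => 0) (k : ℕ) :
    ∑ σ, raiseIter k a σ * raiseIter k b σ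
      = (∏ i ∈ Finset.range k, ladderCoeff (V := V) n i) * ∑ σ, a σ * b σ := by
  induction k with
  | zero => simp [raiseIter]
  | succ k ih => rw [inner_raiseIter_succ a b n hsb hlb k, ih, Finset.prod_range_succ]; ring

/-- the norm version. -/
theorem normSq_raiseIter (b : (V → Fin 2) → ℝ) (n : ℝ)
    (hsb : ∀ ν, b ν ≠ 0 → zerosCard ν = n) (hlb : lowerSum b = fun _ => 0) (k : ℕ) :
    ∑ σ, raiseIter k b σ ^ 2 = (∏ i ∈ Finset.range k, ladderCoeff (V := V) n i) * ∑ σ, b σ ^ 2 := by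
  have h := inner_raiseIter b b n hsb hlb k
  simpa [sq] using h

/-- **THE CG RATIO.**  `∏_{i<n-2} (i+1)(2S−4−i) · (n(n−1))² / ∏_{i<n} (i+1)(2S−i)` is the Clebsch–Gordan shape:
here recorded as the algebraic identity behind memo §156 (L4) for the two products (real `S`, natural `n ≥ 2`):
`(n(n-1))² ∏_{i<n-2}(i+1)(2S-4-i) · [2S(2S-1)(2S-2)(2S-3)] = ∏_{i<n}(i+1)(2S-i) · (S-M)(S-M-1)(S+M)(S+M-1)`
with `M = S - n`. -/
theorem cg_ratio_identity (S : ℝ) (m : ℕ) :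
    (((m:ℝ) + 2) * ((m:ℝ) + 1)) ^ 2 * (∏ i ∈ Finset.range m, (((i:ℝ) + 1) * (2 * S - 4 - i)))
        * (2 * S * (2 * S - 1) * (2 * S - 2) * (2 * S - 3))
      = (∏ i ∈ Finset.range (m + 2), (((i:ℝ) + 1) * (2 * S - i)))
        * (((m:ℝ) + 2) * ((m:ℝ) + 1) * (2 * S - (m + 2)) * (2 * S - (m + 2) - 1)) := by
  induction m with
  | zero => simp [Finset.prod_range_succ]; ring
  | succ m ih =>
      have hm : ((m:ℝ) + 1) ≠ 0 := by positivity
      rw [show m + 1 + 2 = (m + 2) + 1 from by ring, Finset.prod_range_succ, Finset.prod_range_succ]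
      apply mul_left_cancel₀ hm
      push_cast
      linear_combination (((m:ℝ) + 3) ^ 2 * (2 * S - 4 - m)) * ih

end LoweringNorm


/-! ## Part G — THE SQUARE-COMPLETION PERTURBATION IDENTITY (memo §156 (L5)): resolvent-free, spectral-theorem-free

For symmetric `A = H₀ − e₀ ⪰ 0` with `A φ₀ = 0`, a first-order vector `φ₁ ⟂ φ₀` solving `A φ₁ = −(W φ₀ − w φ₀)`, and ANY
vector `ψ = α φ₀ + χ`, `χ = ηα φ₁ + ρ`, `ρ ⟂ φ₀`:
`⟨ψ, (A + ηW) ψ⟩ = ηα² ⟨φ₀, Wφ₀⟩ − η²α² ⟨φ₁, Aφ₁⟩ + ⟨ρ, Aρ⟩ + η ⟨χ, Wχ⟩` — the cross terms cancel exactly.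
Fed with the Rayleigh–Ritz minimiser and a gap `⟨ρ, Aρ⟩ ≥ γ‖ρ‖²` it yields `‖ρ‖ = O(η^{3/2})`, i.e. the sector ground
state is `α(φ₀ + ηφ₁) + O(η^{3/2})` — all that Theorem P′ needs (memo §156 (L6)). -/

section SquareCompletion

open Matrix

variable {ι : Type} [Fintype ι]

/-- **SQUARE-COMPLETION IDENTITY.** [folklore] -/
theorem square_completion (A W : (ι → ℝ) →ₗ[ℝ] (ι → ℝ))
    (hA : ∀ f g : ι → ℝ, f ⬝ᵥ A g = A f ⬝ᵥ g) (hW : ∀ f g : ι → ℝ, f ⬝ᵥ W g = W f ⬝ᵥ g)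
    (φ₀ φ₁ ρ : ι → ℝ) (η α w : ℝ) (hAφ₀ : A φ₀ = 0) (h01 : φ₀ ⬝ᵥ φ₁ = 0) (h0ρ : φ₀ ⬝ᵥ ρ = 0)
    (hfirst : A φ₁ = -(W φ₀ - w • φ₀)) :
    (α • φ₀ + ((η * α) • φ₁ + ρ)) ⬝ᵥ (A (α • φ₀ + ((η * α) • φ₁ + ρ)) + η • W (α • φ₀ + ((η * α) • φ₁ + ρ)))
      = η * α ^ 2 * (φ₀ ⬝ᵥ W φ₀) - η ^ 2 * α ^ 2 * (φ₁ ⬝ᵥ A φ₁) + ρ ⬝ᵥ A ρ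
        + η * (((η * α) • φ₁ + ρ) ⬝ᵥ W ((η * α) • φ₁ + ρ)) := by
  -- the atoms and their relations
  have r1 : φ₀ ⬝ᵥ A ρ = 0 := by rw [hA, hAφ₀, zero_dotProduct]
  have r2 : φ₀ ⬝ᵥ A φ₁ = 0 := by rw [hA, hAφ₀, zero_dotProduct]
  have r3 : φ₁ ⬝ᵥ A ρ = ρ ⬝ᵥ A φ₁ := by rw [hA, dotProduct_comm]
  have hρ0 : ρ ⬝ᵥ φ₀ = 0 := by rw [dotProduct_comm]; exact h0ρ
  have h10 : φ₁ ⬝ᵥ φ₀ = 0 := by rw [dotProduct_comm]; exact h01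
  have r4 : ρ ⬝ᵥ A φ₁ = -(ρ ⬝ᵥ W φ₀) := by
    rw [hfirst, dotProduct_neg, dotProduct_sub, dotProduct_smul, hρ0, smul_eq_mul, mul_zero, sub_zero]
  have r5 : φ₀ ⬝ᵥ W φ₁ = φ₁ ⬝ᵥ W φ₀ := by rw [hW, dotProduct_comm]
  have r6 : φ₁ ⬝ᵥ W φ₀ = -(φ₁ ⬝ᵥ A φ₁) := by
    have : W φ₀ = -(A φ₁) + w • φ₀ := by rw [hfirst]; simp
    rw [this, dotProduct_add, dotProduct_neg, dotProduct_smul, h10, smul_eq_mul, mul_zero, add_zero]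
  have r7 : φ₀ ⬝ᵥ W ρ = ρ ⬝ᵥ W φ₀ := by rw [hW, dotProduct_comm]
  have r8 : φ₁ ⬝ᵥ A φ₀ = 0 := by rw [hAφ₀, dotProduct_zero]
  have r9 : ρ ⬝ᵥ A φ₀ = 0 := by rw [hAφ₀, dotProduct_zero]
  have r10 : φ₀ ⬝ᵥ A φ₀ = 0 := by rw [hAφ₀, dotProduct_zero]
  have r11 : φ₁ ⬝ᵥ W ρ = ρ ⬝ᵥ W φ₁ := by rw [hW, dotProduct_comm]
  -- expand
  simp only [map_add, map_smul, dotProduct_add, add_dotProduct, dotProduct_smul, smul_dotProduct,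
    smul_eq_mul]
  rw [r1, r2, r3, r4, r5, r6, r7, r8, r9, r10]
  ring

/-- **CONSEQUENCE (the η^{3/2} remainder).**  If in addition `⟨ρ, Aρ⟩ ≥ γ‖ρ‖²` (gap on `φ₀^⟂`, `ρ ⟂ φ₀`), the
quadratic form at `ψ` is at most the trial value `ηα²⟨φ₀,Wφ₀⟩ − η²α²⟨φ₁,Aφ₁⟩ + c₁η³` (Rayleigh–Ritz against
`φ₀ + ηφ₁`, bookkeeping folded into `c₁`), and `|⟨χ,Wχ⟩| ≤ c₂ η²` (from `‖χ‖ = O(η)`), then `γ‖ρ‖² ≤ (c₁ + c₂) η³`.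
[folklore] -/
theorem remainder_three_halves (A W : (ι → ℝ) →ₗ[ℝ] (ι → ℝ))
    (hA : ∀ f g : ι → ℝ, f ⬝ᵥ A g = A f ⬝ᵥ g) (hW : ∀ f g : ι → ℝ, f ⬝ᵥ W g = W f ⬝ᵥ g)
    (φ₀ φ₁ ρ : ι → ℝ) (η α w γ c₁ c₂ : ℝ) (hAφ₀ : A φ₀ = 0) (h01 : φ₀ ⬝ᵥ φ₁ = 0) (h0ρ : φ₀ ⬝ᵥ ρ = 0)
    (hfirst : A φ₁ = -(W φ₀ - w • φ₀)) (hη : 0 ≤ η)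
    (hgap : γ * (ρ ⬝ᵥ ρ) ≤ ρ ⬝ᵥ A ρ)
    (hRR : (α • φ₀ + ((η * α) • φ₁ + ρ)) ⬝ᵥ (A (α • φ₀ + ((η * α) • φ₁ + ρ)) + η • W (α • φ₀ + ((η * α) • φ₁ + ρ)))
      ≤ η * α ^ 2 * (φ₀ ⬝ᵥ W φ₀) - η ^ 2 * α ^ 2 * (φ₁ ⬝ᵥ A φ₁) + c₁ * η ^ 3)
    (hWχ : |((η * α) • φ₁ + ρ) ⬝ᵥ W ((η * α) • φ₁ + ρ)| ≤ c₂ * η ^ 2) :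
    γ * (ρ ⬝ᵥ ρ) ≤ (c₁ + c₂) * η ^ 3 := by
  have hid := square_completion A W hA hW φ₀ φ₁ ρ η α w hAφ₀ h01 h0ρ hfirst
  rw [hid] at hRR
  have hx := (abs_le.mp hWχ).1
  nlinarith [mul_nonneg hη (sq_nonneg η)]

end SquareCompletion

end Summit.HubbardSuperconductivity.HubbardSuperconductivity.Theorems.AnisotropyChord.Tower
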